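import Literature.NumberTheory.LFunctions.CharZeroSum
import Literature.NumberTheory.LFunctions.ZetaZeroReciprocalSum
import HarnessLib

/-!
# `Σ_ρ m(ρ)/(c² + (γ − t)²) ≪ c⁻² log(q(|t|+4))` for `L(s, χ)` and for `ζ`

Topic `Literature/NumberTheory/LFunctions`. Everything in this file is PROVED (no definitions).
The quantitative companions of `ExplicitPsiChar.summable_zeroOrder_div_one_add_sq` and
`ZetaZeroSum.summable_zeroOrder_div_one_add_sq`: summing the unit-window counts
`N(t+1, χ) − N(t, χ) ≪ log q(|t|+4)` (Montgomery–Vaughan Thm. 10.17 / 10.13, in the tree as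
`ExplicitPsiChar.exists_sum_window_le` and `exists_sum_zetaZeroWindow_le`) over the windows
`k − 1/2 ≤ γ − t < k + 1/2`, `k ∈ ℤ`:

* `ExplicitPsiChar.exists_tsum_zeroOrder_div_sq_le` — for primitive `χ` mod `q > 1`, `0 < c ≤ 1`,
  real `t`: `Σ_ρ m(ρ)/(c² + (Im ρ − t)²) ≤ (C/c²)(log q + log(|t| + 4))` over the non-trivial zeros;
* `ZetaZeroSum.exists_tsum_zeroOrder_div_sq_le` — the same for `ζ`:
  `Σ_ρ m(ρ)/(c² + (Im ρ − t)²) ≤ (C/c²) log(|t| + 4)`.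

(Montgomery–Vaughan Lemma 12.1 / (12.4): `Σ_ρ 1/(1 + (t − γ)²) ≪ log qτ`.) These control the
"far" zeros in Heath-Brown's Lemma 3.1 / Lemma 5.1 error terms.

## References

* H. L. Montgomery, R. C. Vaughan, *Multiplicative Number Theory I*, Thm. 10.13, Thm. 10.17,
  Lemma 12.1. [cite: MontgomeryVaughan2007, Theorem 10.17]
-/

noncomputable section

open Complex Filter Topology Set Finset
open scoped ComplexConjugate

namespace Literature.NumberTheory.LFunctions

/-! ### A summable weight over `ℤ` -/

/-- `S_w := Σ_{k ∈ ℤ} (1 + log(|k| + 4))/(1 + k²)` is finite and positive. [folklore] -/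
theorem summable_one_add_log_div : Summable fun k : ℤ => (1 + Real.log (|(k : ℝ)| + 4)) / (1 + (k : ℝ) ^ 2) :=
  ExplicitPsiChar.summable_window_weight zero_le_one

/-- The window inequality: if `|x − k| ≤ 1/2` (`k ∈ ℤ`) and `0 < c ≤ 1` then
`1/(c² + x²) ≤ 4/(c² (1 + k²))`. [folklore] -/
theorem one_div_sq_add_sq_le {c x : ℝ} {k : ℤ} (hc : 0 < c) (hc1 : c ≤ 1) (hx : |x - k| ≤ 1 / 2) :
    1 / (c ^ 2 + x ^ 2) ≤ 4 / (c ^ 2 * (1 + (k : ℝ) ^ 2)) := by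
  rw [div_le_div_iff₀ (by positivity) (by positivity), one_mul]
  -- `c²(1+k²) ≤ 4(c² + x²)`: `c² k² ≤ k² ≤ (|x| + 1/2)² ≤ 2x² + 1/2`… and `c² ≤ 1`
  have h1 : |(k : ℝ)| ≤ |x| + 1 / 2 := by
    have := abs_sub_abs_le_abs_sub (k : ℝ) x
    rw [abs_sub_comm] at this
    linarith
  have h2 : (k : ℝ) ^ 2 ≤ (|x| + 1 / 2) ^ 2 := by
    rw [← sq_abs (k : ℝ)]; exact pow_le_pow_left₀ (abs_nonneg _) h1 2
  have hc2 : c ^ 2 ≤ 1 := by nlinarith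
  nlinarith [sq_nonneg (|x| - 1 / 2), sq_abs x, abs_nonneg x, sq_nonneg c,
    mul_le_mul_of_nonneg_right hc2 (sq_nonneg (k : ℝ))]

/-- `log(|t + k| + 4) ≤ log(|t| + 4) + log(|k| + 4)`. [folklore] -/
theorem log_abs_add_le (t k : ℝ) :
    Real.log (|t + k| + 4) ≤ Real.log (|t| + 4) + Real.log (|k| + 4) := by
  rw [← Real.log_mul (by positivity) (by positivity)]
  refine Real.log_le_log (by positivity) ?_
  nlinarith [abs_add_le t k, abs_nonneg t, abs_nonneg k]

namespace ExplicitPsiChar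

variable {q : ℕ} [NeZero q] {χ : DirichletCharacter ℂ q}

/-- **`Σ_ρ m(ρ)/(c² + (γ − t)²) ≤ (C/c²) ℒ`** for primitive `χ` mod `q > 1`, `0 < c ≤ 1`, real `t`,
`ℒ = log q + log(|t| + 4)`; the sum is over the non-trivial zeros with multiplicity and converges.
[cite: MontgomeryVaughan2007, Lemma 12.1 ((12.4), via Theorem 10.17)] -/
theorem exists_tsum_zeroOrder_div_sq_le :
    ∃ C : ℝ, 0 < C ∧ ∀ (q : ℕ) [NeZero q] (χ : DirichletCharacter ℂ q), χ.IsPrimitive → 1 < q →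
      ∀ t c : ℝ, 0 < c → c ≤ 1 →
        Summable (fun ρ : charNontrivialZeros χ =>
          (DirichletDisc.zeroOrder χ (ρ : ℂ) : ℝ) / (c ^ 2 + ((ρ : ℂ).im - t) ^ 2)) ∧
        ∑' ρ : charNontrivialZeros χ,
            (DirichletDisc.zeroOrder χ (ρ : ℂ) : ℝ) / (c ^ 2 + ((ρ : ℂ).im - t) ^ 2) ≤
          C / c ^ 2 * (Real.log q + Real.log (|t| + 4)) := by
  classical
  obtain ⟨Cw, hCw0, hCw⟩ := exists_sum_window_le
  set S : ℝ := ∑' k : ℤ, (1 + Real.log (|(k : ℝ)| + 4)) / (1 + (k : ℝ) ^ 2) with hS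
  have hS0 : 0 ≤ S := tsum_nonneg fun k => by
    have : 0 ≤ Real.log (|(k : ℝ)| + 4) := Real.log_nonneg (by linarith [abs_nonneg (k : ℝ)])
    positivity
  refine ⟨4 * Cw * S + 1, by positivity, fun q _ χ hprim hq t c hc hc1 => ?_⟩
  have hq1 : (1 : ℝ) < q := by exact_mod_cast hq
  have hlogq : 0 < Real.log q := Real.log_pos hq1
  have hlog4 : 1 ≤ Real.log (|t| + 4) := by
    rw [Real.le_log_iff_exp_le (by positivity)]; linarith [Real.exp_one_lt_d9, abs_nonneg t]
  set ℒ : ℝ := Real.log q + Real.log (|t| + 4) with hℒ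
  have hℒ1 : 1 ≤ ℒ := by linarith
  set f : charNontrivialZeros χ → ℝ := fun ρ =>
    (DirichletDisc.zeroOrder χ (ρ : ℂ) : ℝ) / (c ^ 2 + ((ρ : ℂ).im - t) ^ 2) with hf
  have hf0 : ∀ ρ, 0 ≤ f ρ := fun ρ => by positivity
  set g : ℤ → ℝ := fun k => 4 * Cw / c ^ 2 * ℒ * ((1 + Real.log (|(k : ℝ)| + 4)) / (1 + (k : ℝ) ^ 2))
    with hg
  have hgsum : Summable g := summable_one_add_log_div.mul_left _
  have hg0 : ∀ k, 0 ≤ g k := fun k => by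
    have : 0 ≤ Real.log (|(k : ℝ)| + 4) := Real.log_nonneg (by linarith [abs_nonneg (k : ℝ)])
    positivity
  have htsum_g : ∑' k, g k = 4 * Cw / c ^ 2 * ℒ * S := by rw [hg, tsum_mul_left]
  -- the bound on finite partial sums
  have hbound : ∀ u : Finset (charNontrivialZeros χ), ∑ ρ ∈ u, f ρ ≤ 4 * Cw / c ^ 2 * ℒ * S := by
    intro u
    set kf : charNontrivialZeros χ → ℤ := fun ρ => round ((ρ : ℂ).im - t) with hkf
    rw [← Finset.sum_fiberwise_of_maps_to (g := kf) (fun ρ _ => Finset.mem_image_of_mem kf ‹_›),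
      ← htsum_g]
    refine (Finset.sum_le_sum fun k hk => ?_).trans (hgsum.sum_le_tsum _ (fun k _ => hg0 k))
    have hfib : ∀ ρ ∈ u.filter (fun ρ => kf ρ = k), |(ρ : ℂ).im - t - k| ≤ 1 / 2 := by
      intro ρ hρ
      have h := (Finset.mem_filter.1 hρ).2
      rw [hkf] at h
      rw [← h]
      exact abs_sub_round _
    have hwin := hCw q χ hprim hq (t + k) ((u.filter (fun ρ => kf ρ = k)).image Subtype.val) (by
      intro z hz
      obtain ⟨ρ, hρ, rfl⟩ := Finset.mem_image.1 hz
      refine ⟨ρ.2.1, ρ.2.2.1, ρ.2.2.2, ?_⟩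
      have := hfib ρ hρ
      rwa [show (ρ : ℂ).im - (t + k) = (ρ : ℂ).im - t - k by ring])
    rw [Finset.sum_image (fun a _ b _ h => Subtype.ext h)] at hwin
    have hwin' : ∑ x ∈ u.filter (fun ρ => kf ρ = k), (DirichletDisc.zeroOrder χ (x : ℂ) : ℝ) ≤
        Cw * ℒ * (1 + Real.log (|(k : ℝ)| + 4)) := by
      refine hwin.trans ?_
      have h1 := log_abs_add_le t k
      have h2 : 0 ≤ Real.log (|(k : ℝ)| + 4) := Real.log_nonneg (by linarith [abs_nonneg (k : ℝ)])
      have : Real.log q + Real.log (|t + k| + 4) ≤ ℒ * (1 + Real.log (|(k : ℝ)| + 4)) := by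
        rw [hℒ]; nlinarith
      nlinarith
    calc ∑ ρ ∈ u.filter (fun ρ => kf ρ = k), f ρ
        ≤ ∑ ρ ∈ u.filter (fun ρ => kf ρ = k),
            4 / (c ^ 2 * (1 + (k : ℝ) ^ 2)) * (DirichletDisc.zeroOrder χ (ρ : ℂ) : ℝ) := by
          refine Finset.sum_le_sum fun ρ hρ => ?_
          rw [hf]
          dsimp only
          rw [div_eq_mul_one_div, mul_comm]
          exact mul_le_mul_of_nonneg_right (one_div_sq_add_sq_le hc hc1 (hfib ρ hρ)) (Nat.cast_nonneg _)
      _ = 4 / (c ^ 2 * (1 + (k : ℝ) ^ 2)) *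
            ∑ ρ ∈ u.filter (fun ρ => kf ρ = k), (DirichletDisc.zeroOrder χ (ρ : ℂ) : ℝ) := by
          rw [Finset.mul_sum]
      _ ≤ 4 / (c ^ 2 * (1 + (k : ℝ) ^ 2)) * (Cw * ℒ * (1 + Real.log (|(k : ℝ)| + 4))) :=
          mul_le_mul_of_nonneg_left hwin' (by positivity)
      _ = g k := by rw [hg]; field_simp
  have hsum : Summable f := summable_of_sum_le hf0 hbound
  refine ⟨hsum, (hsum.tsum_le_of_sum_le hbound).trans ?_⟩
  have : 4 * Cw / c ^ 2 * ℒ * S = (4 * Cw * S) / c ^ 2 * ℒ := by ring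
  rw [this]
  refine mul_le_mul_of_nonneg_right ?_ (by positivity)
  exact div_le_div_of_nonneg_right (by linarith) (by positivity)

end ExplicitPsiChar

namespace ZetaZeroSum

/-- **`Σ_ρ m(ρ)/(c² + (γ − t)²) ≤ (C/c²) log(|t| + 4)`** for `ζ`, `0 < c ≤ 1`, real `t`; the sum over
the non-trivial zeros with multiplicity (the zeros with `Re ρ < 1/4` are reflected by `ρ ↦ 1 − ρ̄`,
which preserves the ordinate and the multiplicity). [cite: MontgomeryVaughan2007, Lemma 12.1 (via Theorem 10.13)] -/
theorem exists_tsum_zeroOrder_div_sq_le :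
    ∃ C : ℝ, 0 < C ∧ ∀ t c : ℝ, 0 < c → c ≤ 1 →
      Summable (fun ρ : ↥RHWave0.riemannZetaNontrivialZeros =>
        (riemannZetaZeroOrder (ρ : ℂ) : ℝ) / (c ^ 2 + ((ρ : ℂ).im - t) ^ 2)) ∧
      ∑' ρ : ↥RHWave0.riemannZetaNontrivialZeros,
          (riemannZetaZeroOrder (ρ : ℂ) : ℝ) / (c ^ 2 + ((ρ : ℂ).im - t) ^ 2) ≤
        C / c ^ 2 * Real.log (|t| + 4) := by
  classical
  obtain ⟨Cw, hCw0, hCw⟩ := exists_sum_zetaZeroWindow_le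
  set S : ℝ := ∑' k : ℤ, (1 + Real.log (|(k : ℝ)| + 4)) / (1 + (k : ℝ) ^ 2) with hS
  have hS0 : 0 ≤ S := tsum_nonneg fun k => by
    have : 0 ≤ Real.log (|(k : ℝ)| + 4) := Real.log_nonneg (by linarith [abs_nonneg (k : ℝ)])
    positivity
  refine ⟨8 * Cw * S + 1, by positivity, fun t c hc hc1 => ?_⟩
  have hlog4 : 1 ≤ Real.log (|t| + 4) := by
    rw [Real.le_log_iff_exp_le (by positivity)]; linarith [Real.exp_one_lt_d9, abs_nonneg t]
  set ℒ : ℝ := Real.log (|t| + 4) with hℒ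
  set f : ↥RHWave0.riemannZetaNontrivialZeros → ℝ := fun ρ =>
    (riemannZetaZeroOrder (ρ : ℂ) : ℝ) / (c ^ 2 + ((ρ : ℂ).im - t) ^ 2) with hf
  have hf0 : ∀ ρ, 0 ≤ f ρ := fun ρ => div_nonneg (zeroOrder_nonneg ρ) (by positivity)
  set g : ℤ → ℝ := fun k => 4 * Cw / c ^ 2 * ℒ * ((1 + Real.log (|(k : ℝ)| + 4)) / (1 + (k : ℝ) ^ 2))
    with hg
  have hgsum : Summable g := summable_one_add_log_div.mul_left _
  have hg0 : ∀ k, 0 ≤ g k := fun k => by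
    have : 0 ≤ Real.log (|(k : ℝ)| + 4) := Real.log_nonneg (by linarith [abs_nonneg (k : ℝ)])
    positivity
  have htsum_g : ∑' k, g k = 4 * Cw / c ^ 2 * ℒ * S := by rw [hg, tsum_mul_left]
  -- window count at `τ = t + k` for zeros with `Re ≥ 1/4`, in the form we need
  have hwindow : ∀ (k : ℤ) (P : Finset ℂ), (∀ z ∈ P, riemannZeta z = 0 ∧ 1 / 4 ≤ z.re ∧ |z.im - t - k| ≤ 1 / 2) →
      ∑ z ∈ P, (riemannZetaZeroOrder z : ℝ) ≤ Cw * ℒ * (1 + Real.log (|(k : ℝ)| + 4)) := by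
    intro k P hP
    have hsub : P ⊆ (zetaZeroWindow_finite (t + k)).toFinset := by
      intro z hz
      rw [Set.Finite.mem_toFinset]
      obtain ⟨h0, h1, h2⟩ := hP z hz
      exact ⟨h0, h1, by rwa [show z.im - (t + k) = z.im - t - k by ring]⟩
    have h1 := (Finset.sum_le_sum_of_subset_of_nonneg hsub fun z hz _ =>
      riemannZetaZeroOrder_nonneg_of_zero ((Set.Finite.mem_toFinset _).1 hz).1).trans (hCw (t + k))
    refine h1.trans ?_
    have h2 : Real.log (|t + k| + 2) ≤ Real.log (|t + k| + 4) := Real.log_le_log (by positivity) (by linarith)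
    have h3 := log_abs_add_le t k
    have h4 : 0 ≤ Real.log (|(k : ℝ)| + 4) := Real.log_nonneg (by linarith [abs_nonneg (k : ℝ)])
    have : Real.log (|t + k| + 2) ≤ ℒ * (1 + Real.log (|(k : ℝ)| + 4)) := by rw [hℒ]; nlinarith
    nlinarith
  -- partial sums: split each `u` into `Re ≥ 1/4` and `Re < 1/4` (reflected)
  have hbound : ∀ u : Finset ↥RHWave0.riemannZetaNontrivialZeros, ∑ ρ ∈ u, f ρ ≤ 2 * (4 * Cw / c ^ 2 * ℒ * S) := by
    intro u
    -- generic fibre estimate for a finset of complex zeros with `Re ≥ 1/4`, valued by `F z = m(z)/(c²+(Im z − t)²)`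
    have hgen : ∀ P : Finset ℂ, (∀ z ∈ P, riemannZeta z = 0 ∧ 1 / 4 ≤ z.re) →
        ∑ z ∈ P, (riemannZetaZeroOrder z : ℝ) / (c ^ 2 + (z.im - t) ^ 2) ≤ 4 * Cw / c ^ 2 * ℒ * S := by
      intro P hP
      set kf : ℂ → ℤ := fun z => round (z.im - t) with hkf
      rw [← Finset.sum_fiberwise_of_maps_to (g := kf) (fun z _ => Finset.mem_image_of_mem kf ‹_›),
        ← htsum_g]
      refine (Finset.sum_le_sum fun k hk => ?_).trans (hgsum.sum_le_tsum _ (fun k _ => hg0 k))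
      have hfib : ∀ z ∈ P.filter (fun z => kf z = k), |z.im - t - k| ≤ 1 / 2 := by
        intro z hz
        have h := (Finset.mem_filter.1 hz).2
        rw [hkf] at h
        rw [← h]
        exact abs_sub_round _
      have hwin := hwindow k (P.filter (fun z => kf z = k)) fun z hz =>
        ⟨(hP z (Finset.mem_filter.1 hz).1).1, (hP z (Finset.mem_filter.1 hz).1).2, hfib z hz⟩
      calc ∑ z ∈ P.filter (fun z => kf z = k), (riemannZetaZeroOrder z : ℝ) / (c ^ 2 + (z.im - t) ^ 2)
          ≤ ∑ z ∈ P.filter (fun z => kf z = k),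
              4 / (c ^ 2 * (1 + (k : ℝ) ^ 2)) * (riemannZetaZeroOrder z : ℝ) := by
            refine Finset.sum_le_sum fun z hz => ?_
            rw [div_eq_mul_one_div, mul_comm]
            exact mul_le_mul_of_nonneg_right (one_div_sq_add_sq_le hc hc1 (hfib z hz))
              (riemannZetaZeroOrder_nonneg_of_zero (hP z (Finset.mem_filter.1 hz).1).1)
        _ = 4 / (c ^ 2 * (1 + (k : ℝ) ^ 2)) *
              ∑ z ∈ P.filter (fun z => kf z = k), (riemannZetaZeroOrder z : ℝ) := by rw [Finset.mul_sum]
        _ ≤ 4 / (c ^ 2 * (1 + (k : ℝ) ^ 2)) * (Cw * ℒ * (1 + Real.log (|(k : ℝ)| + 4))) :=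
            mul_le_mul_of_nonneg_left hwin (by positivity)
        _ = g k := by rw [hg]; field_simp
    -- the right part
    set uR := u.filter (fun ρ : ↥RHWave0.riemannZetaNontrivialZeros => (1 / 4 : ℝ) ≤ (ρ : ℂ).re) with huR
    set uL := u.filter (fun ρ : ↥RHWave0.riemannZetaNontrivialZeros => ¬ (1 / 4 : ℝ) ≤ (ρ : ℂ).re) with huL
    rw [← Finset.sum_filter_add_sum_filter_not u
      (fun ρ : ↥RHWave0.riemannZetaNontrivialZeros => (1 / 4 : ℝ) ≤ (ρ : ℂ).re), two_mul]
    refine add_le_add ?_ ?_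
    · have h := hgen (uR.image Subtype.val) (by
        intro z hz
        obtain ⟨ρ, hρ, rfl⟩ := Finset.mem_image.1 hz
        exact ⟨ZetaZeros.riemannZetaNontrivialZeros.zeta_eq_zero ρ.2, (Finset.mem_filter.1 hρ).2⟩)
      rw [Finset.sum_image (fun a _ b _ h => Subtype.ext h)] at h
      exact h
    · -- reflect: `ρ ↦ 1 − conj ρ`
      set r : ↥RHWave0.riemannZetaNontrivialZeros → ℂ := fun ρ => 1 - conj (ρ : ℂ) with hr
      have hinj : Set.InjOn r ↑uL := by
        intro a _ b _ h
        have h' : conj ((a : ↥RHWave0.riemannZetaNontrivialZeros) : ℂ) = conj ((b : ↥RHWave0.riemannZetaNontrivialZeros) : ℂ) :=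
          sub_right_injective h
        exact Subtype.ext (by simpa using congrArg conj h')
      have h := hgen (uL.image r) (by
        intro z hz
        obtain ⟨ρ, hρ, rfl⟩ := Finset.mem_image.1 hz
        have hlt : ¬ (1 / 4 : ℝ) ≤ (ρ : ℂ).re := (Finset.mem_filter.1 hρ).2
        refine ⟨ZetaZeros.riemannZetaNontrivialZeros.zeta_eq_zero
          (ZetaZeros.riemannZetaNontrivialZeros.one_sub_conj_mem ρ.2), ?_⟩
        simp only [hr, sub_re, one_re, conj_re]
        linarith)
      rw [Finset.sum_image hinj] at h
      refine le_trans (le_of_eq (Finset.sum_congr rfl fun ρ hρ => ?_)) h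
      have h0 := ZetaZeros.riemannZetaNontrivialZeros.re_pos ρ.2
      have h1 := ZetaZeros.riemannZetaNontrivialZeros.re_lt_one ρ.2
      simp only [hf, hr, riemannZetaZeroOrder_one_sub_conj h0 h1, sub_im, one_im, conj_im, zero_sub, neg_neg]
  have hsum : Summable f := summable_of_sum_le hf0 hbound
  refine ⟨hsum, (hsum.tsum_le_of_sum_le hbound).trans ?_⟩
  have : 2 * (4 * Cw / c ^ 2 * ℒ * S) = (8 * Cw * S) / c ^ 2 * ℒ := by ring
  rw [this]
  refine mul_le_mul_of_nonneg_right ?_ (by linarith)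
  exact div_le_div_of_nonneg_right (by linarith) (by positivity)

end ZetaZeroSum

end Literature.NumberTheory.LFunctions

end
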